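import Literature.MathematicalPhysics.QuantumFieldTheory.Balaban1983to89.B8SockSP5BaseSrc

/-!
# `Balaban1983to89.B8SockSP5BaseSrcGamma` — [Balaban1985RegularSpaces] THE N05 KNIT's SOURCED BASE SOCKET `SP5base` (Prop. 5 at level 0, Theorem 8's (1.146))
# AT ONE MEMBER, PROVIDED, EDITION γ — the socket text's (1.35) antecedent in print's p. 77 convention «box ⊂ Ω_{j−1}» (LOCATED-SOCK135); dag-n05-d's
# `B8SockSP5BaseSrc.sp5base_of_sockLettersRD_src` with that one antecedent line re-typed (the base body reads no class∕(1.35)∕Prop-3 step)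

statement-level skeleton of published theorems with citation tags; proofs where landed; nothing here is a claim about the Yang–Mills mass gap

T. Bałaban, *Spaces of regular gauge field configurations on a lattice and gauge fixing conditions*, Commun. Math. Phys. **99** (1985) 75–102
`[Balaban1985RegularSpaces]` ("B8"; printed page = PDF page + 74): Prop. 5 pp. 93–94, (1.66) p. 88, (1.106)–(1.110) p. 94, p. 95 («For j = 0 we apply simply
Proposition 5»), (1.35) p. 82, p. 77, Thm 8 (1.146) p. 101; [4] = [Balaban1985BackgroundPropagators] Thm 3.1 p. 397, (3.25) p. 394.
PDF held: `paper:balaban1985-cmp99-regular-spaces-gauge-fixing`.  STATUS: published, refereed.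

CITATION HEADER (lean-in-tree rule).  Cell `pub-ymgap` (YM Track A, DAG node N05 = [B8], HUMAN RULING D-0062 ∕ D-0149 width seats), seat
`pub-ymgap-dag-n05-w4` (g0): CLAIM-2 (cell bus 2026-08-27 l.24971: the EXISTENCE-side sourced Prop-5 socket providers γ), W-SEAT-START-LIST v3 §n05 item 4.
WHY THIS FILE.  The knit's three sourced Prop-5 sockets `SP5base`∕`SP5`∕`SP5u` share ONE guard block, whose (1.35) antecedent the edition γ states in print's
p. 77 convention (boxes in `Ω_{j−1}`), so that the level-`m ≥ 1` providers (`B8SockSP5ProviderSrcGamma`, `B8SockSP5uProviderSrcGamma`) exist over print's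
crossing-bond class; for the junction to close BY NAME the BASE socket must be stated in the same text.  dag-n05-d's `B8SockSP5BaseSrc.sp5base_of_sockLettersRD_src`
provides the base socket without reading (1.35) at all (level 0: the datum is `U′` itself, (1.69) = (1.66)₀) — THIS FILE re-types its conclusion's (1.35)
antecedent line and keeps the proof VERBATIM: ★ `sp5base_of_sockLettersRD_src_γ` (`hP5base_of_HFP_src` + `B8SockHFPRDSrc.sockHFP₀_body_of_join_RD_src` BY NAME).
Kind «kernel-checked proof», one theorem, no `def`, no existing module modified.

HONEST SCOPE ∕ A6.  Assembly by name; [4]'s letters (`SLet : SockLettersRD`) and the windows are displayed HYPOTHESES; no b9 socket is read at the base;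
`d ≥ 2`, `L ≥ 2`.  Count-neutral; N05 NOT discharged; no count claim; one finite `𝕋⁴` programme at fixed `ε`, Bałaban as printed; the Yang–Mills mass gap
(Clay) is NOT proved by any of this — R4 closes the conditional finite-`𝕋⁴` rung `BalabanLadder.UV` only; nothing continuum ∕ ℝ⁴ ∕ OS.  No `sorry`, no `def`,
no `instance`, no `notation`.  Unit `pub-ymgap-dag-n05-w4` (g0), 2026-08-28.

RELATED IN THE TREE, NOT DUPLICATED: `B8SockSP5BaseSrc` (dag-n05-d; «box ⊂ Ω_j» text; its `hP5base_of_HFP_src` is USED), `B8SockHFPRDSrc` (dag-n05-d; the base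
body, USED), `B8SockSP5ThresholdsSrc` (dag-n05-d; the thresholds — edition γ in `B8SockSP5ThresholdsSrcGamma`).
-/

noncomputable section

open NormedSpace
open Complex (I I_ne_zero)

namespace Literature.MathematicalPhysics.QuantumFieldTheory.Balaban1983to89.B8SockSP5BaseSrcGamma

open MatrixLog B7Prop1Explicit B7Prop2Explicit B7Prop1Local B7Eq92Concrete
open B7Prop2Explicit (C0 c2')
open B7Prop3Flat (c3)
open B7Prop10General (C6 C4G)
open B7Prop9Flat (C5')
open B7Eq78Linearization (conjR zdBlocking QprimeIter)
open B8Ineq132 (covDerivFwd covDeriv InAk)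
open B8Eq119TwistedAxial (Restr129 InAx bgT)
open B8Eq184Proof (gaugeExp cfgExp)
open B8Eq182Proof (gAd)
open B8Eq188Proof (frakF3)
open B8Lemma1NonAbelian (mulCfg)
open B8Eq140Level (SideTouches)
open B8Eq146AExpansion (iEta expCfg)
open B8Ineq130 (tlo thi)
open B8Thm2LogB (blockTop)
open B8Eq138LandauZd (InR138 covDivB covLap QT)
open B8Ineq125Concrete (C2p)
open B8Eq1117Concrete (XSpace)
open B8ScaledSupNorm (bondNorm msup Bdd weight_mul_norm_le_msup weight_neg_natCast)
open B8Prop5ContractionKLevel (Bd2 Mc Kc)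
open B8LambdaSpaceKLevel (wt)
open B8SockLettersRD (SockLettersRD)
open B8LanF146 (LanF146)
open B8SockHFPRDSrc (sockHFP₀_body_of_join_RD_src)
open B8SockSP5OfLettersSrc (hP5_step_of_HFP_src)
open B8Thm4TruncationLocal (base_datum)

-- `Site` alone could resolve to the torus sites of `Setup.lean`; re-export the `ℤ^d` sites of `B7Prop1Explicit`.
export B7Prop1Explicit (Site)

variable {d : ℕ} {𝔸 : Type*} [CStarAlgebra 𝔸] [Nontrivial 𝔸]

open B8SockSP5BaseSrc (hP5base_of_HFP_src)

variable {L : ℕ} {η : ℝ} {k : ℕ} {Ω : ℕ → Set (Site d)} {Λs : ℕ → ℕ → Set (Site d)}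
  {B₀ B₀' B₀'H B₂' BG BR cL cP γ B₈ : ℝ}

/-- ★ **THE SOURCED SOCKET `SP5base` AT ONE MEMBER FROM [4]'s LETTERS AND A DISPLAYED WINDOWS FAMILY** (module docstring): the body of the N05 knit's `SP5base` binder
(seat n05-c g5's text, source premiss ρ2) at `LanF := LanF146 L k η (Ω 0) Λs U₀ φ`, output bound `8B₀′·5dLB₈·(α₀ + α₁)`.
[cite: Balaban1985RegularSpaces, Prop. 5 (1.106)–(1.110) p.94, p.89, (1.66) p.88, Thm 8 (1.146) p.101; Balaban1985BackgroundPropagators, Thm 3.1 p.397] -/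
theorem sp5base_of_sockLettersRD_src_γ (hd2 : 2 ≤ d) (hL : 2 ≤ L) (hη : 0 < η) (hk : 1 ≤ k) (hΩ : ∀ j, Ω (j + 1) ⊆ Ω j)
    (htw : ∀ m, m ≤ k → ∀ j, j ≤ m → ∀ y ∈ Λs m j, ∀ x, InBox (tlo L y j) (thi L y j) x → x ∈ Ω j)
    (hB₀' : 0 < B₀') (hB₀'H : 0 < B₀'H) (hB₂' : 0 ≤ B₂') (hBG : 0 ≤ BG) (hBR : 0 ≤ BR) (hγ : 0 ≤ γ) (hB₈ : 0 < B₈)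
    (hB8two : 2 ≤ 5 * (d : ℝ) * L * B₈)
    (SLet : SockLettersRD (𝔸 := 𝔸) L BG BR B₀'H B₂' cL η k Ω Λs) (hcPL : cP ≤ cL)
    (hwin : ∀ α₀ α₁ : ℝ, 0 < α₀ → 0 < α₁ → α₀ + α₁ ≤ cP →
      ∀ cs α₄ cB cDA hE hE₂ lE lE₂ : ℝ, cs = 5 * (d : ℝ) * L * B₈ * (α₀ + α₁) → α₄ = 8 * B₀' * (5 * (d : ℝ) * L * B₈) * (α₀ + α₁) →
      cB = L * cs → cDA = 2 * (d : ℝ) * (L : ℝ) ^ 2 * cs →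
      hE = B₀'H * (C2p d * (40 * d * cB + α₄) * α₄) → hE₂ = B₂' * (C2p d * (40 * d * cB + α₄) * α₄) →
      lE = B₀'H * (4 * C2p d * (40 * d * cB + 2 * α₄)) → lE₂ = B₂' * (4 * C2p d * (40 * d * cB + 2 * α₄)) →
      C0 d * α₀ ≤ 1 / 3 ∧ 4 * α₀ ≤ c2' d L ∧
      Real.exp (4 * (800 * ((d : ℝ) + 1) ^ 2 * ((d : ℝ) + 4)) * α₀) * (1 + 8 * (131072 * ((d : ℝ) + 1) ^ 2) * cB) ≤ 2 ∧
      2 * cB ≤ c3 d L ∧ 2048 * (d : ℝ) * cB ≤ 1 ∧ 40 * d * cB ≤ 1 / 200 ∧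
      200 * C6 d * (2 * α₄) ≤ 1 ∧ 12000 * ((d : ℝ) + 1) * L * (2 * α₄) ≤ 1 ∧
      C4G d L * (α₀ + 40 * d * cB + 4 * (2 * α₄)) ≤ 1 ∧
      1024 * ((d : ℝ) + 1) * ((d : ℝ) + 4) * L ^ 2 * α₀ ≤ 1 ∧ 32 * ((d : ℝ) + 1) ^ 2 * C6 d * L ^ 2 * α₀ ≤ 1 ∧
      16 * d * C5' d * C6 d * (L : ℝ) ^ 2 * α₀ ≤ 1 ∧ 8 * d * C6 d * L * α₀ ≤ 1 ∧
      40 * d * cB + α₄ ≤ 1 / (4 * B₀'H * (2 * C2p d)) ∧ 2 * C6 d * (40 * d * cB + 4 * α₄) ≤ 1 / 8 ∧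
      cB ≤ 1 / 13 ∧ α₄ / 4 + hE ≤ 1 / 24 ∧ α₄ / 4 + hE ≤ 1 / 140 ∧ 10 * (α₄ / 4 + hE) * BR ≤ 1 / 2 ∧
      BG * Mc d BR (α₄ / 4 + hE) cB (hE₂ + γ * (α₀ + α₁) / 2) cDA ≤ α₄ / 4 ∧
      BG * Kc d BR (α₄ / 4 + hE) cB (hE₂ + γ * (α₀ + α₁) / 2) cDA lE₂ (1 + lE) (1 + lE) ≤ 1 / 2 ∧
      α₄ ≤ 1 / 84 ∧ cs ≤ 1 / 12 ∧ α₁ ≤ 1 / 4) :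
    ∀ α₀ α₁ : ℝ, 0 < α₀ → 0 < α₁ → α₀ + α₁ ≤ cP →
      ∀ U₀ U' : Site d → Fin d → 𝔸ˣ, (∀ x κ, U₀ x κ ∈ unitaryUnits 𝔸) → (∀ x κ, U' x κ ∈ unitaryUnits 𝔸) →
      ∀ φ : Site d → 𝔸, ((InR138 L k η (Ω 0) (Λs k) U₀ φ ∧ (∀ x, IsSelfAdjoint (φ x)) ∧ (∀ x, x ∉ Ω 0 → φ x = 0) ∧
          Bdd L k η (-(2 : ℝ)) (fun j (x : Site d) => x ∈ Ω j) φ) ∧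
        msup L k η (-(2 : ℝ)) (fun j (x : Site d) => x ∈ Ω j) φ < γ * (α₀ + α₁)) →
      InAk L k η α₀ Ω U₀ → InAk L k η α₀ Ω (mulCfg U' U₀) → (∀ m, m ≤ k → InAx L m (Λs m) U₀ (mulCfg U' U₀)) →
      (∀ j, j ≤ k → ∀ (z : Site d) (μ : Fin d), (∀ x, InBox (loK L j z) (bondHiK L j z μ) x → x ∈ Ω (j - 1)) →
        ‖(avgIter L (mulCfg U' U₀) j z μ : 𝔸) - (avgIter L U₀ j z μ : 𝔸)‖ ≤ α₁) →
      (∀ b ∈ {b : Site d × Fin d | SideTouches (Ω 0) b.1 b.2}, ‖((U' b.1 b.2 : 𝔸ˣ) : 𝔸) - 1‖ ≤ α₁) →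
      (∃ (v : Site d → 𝔸ˣ) (lam : Site d → 𝔸), (∀ x, v x ∈ unitaryUnits 𝔸) ∧ (∀ x, x ∉ Ω 0 → v x = 1) ∧
        (∀ j, j ≤ 1 → ∀ b ∈ {b : Site d × Fin d | SideTouches (Ω j) b.1 b.2}, (v b.1 : 𝔸) = ((gaugeExp lam b.1 : 𝔸ˣ) : 𝔸) ∧
        (v (b.1 + e b.2) : 𝔸) = ((gaugeExp lam (b.1 + e b.2) : 𝔸ˣ) : 𝔸)) ∧
        (∀ j, j ≤ 1 → ∀ b ∈ {b : Site d × Fin d | SideTouches (Ω j) b.1 b.2},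
        ‖lam b.1‖ ≤ (8 * B₀' * (5 * (d : ℝ) * L * B₈) * (α₀ + α₁)) ∧ ((L : ℝ) ^ j * η) * ‖covDerivFwd η U₀ b.2 lam b.1‖ ≤ (8 * B₀' * (5 * (d : ℝ) * L * B₈) * (α₀ + α₁))) ∧
        LanF146 L k η (Ω 0) Λs U₀ φ 1 (mgauge U₀ v⁻¹ U') ∧ Restr129 L 1 (Λs 1) U₀ ((1 : Site d → 𝔸ˣ) * v)) := by
  intro α₀ α₁ hα₀ hα₁ hs U₀ U' hU₀ hU' φ hφ h33 h34 hAx h135 h66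
  obtain ⟨⟨hInR, hφsa, hφoff, hBdd⟩, hφn⟩ := hφ
  have hsum : 0 < α₀ + α₁ := add_pos hα₀ hα₁
  obtain ⟨hα3, hα4, hsmall, hc₃, hsc, hα₃', hs₁, hs₂, hs₃, hs₄, hs₅, hs₆, hs₇, hsm, hprod8, hcA', ha₁', hb₁', hθ, h103, h106, hs84, hcs12, hα₁4⟩ :=
    hwin α₀ α₁ hα₀ hα₁ hs _ _ _ _ _ _ _ _ rfl rfl rfl rfl rfl rfl rfl rfl
  have hα₀L : α₀ ≤ cL := by linarith only [hs, hcPL, hα₁]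
  obtain ⟨g, Δ, q, qs, Aw, c, H', g_rightΩ, c_range, hΔ, hqs, hq, hH0, hH1, hH2, hHsupp, hHequiv, hQH, hG, hGsupp, hGreal, hRbd, hRreal⟩ :=
    SLet α₀ hα₀ hα₀L U₀ hU₀ h33 1 le_rfl hk
  -- the source: size `γ(α₀ + α₁)` at the one level, Hermitian
  have hmf : 0 ≤ γ * (α₀ + α₁) := by positivity
  have hf : Bd2 L η 1 Ω φ (γ * (α₀ + α₁)) := by
    intro j hj x hx
    have h := weight_mul_norm_le_msup hBdd (hj.trans hk) (i := x) hx
    have e2 : (-(2 : ℝ)) = -((2 : ℕ) : ℝ) := by norm_num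
    rw [e2, weight_neg_natCast L η 2 j] at h
    have hw : wt L η j ^ 2 = ((L : ℝ) ^ j * η) ^ 2 := rfl
    rw [hw]
    rw [e2] at hφn
    exact h.trans hφn.le
  have hfsa : ∀ j, j ≤ 1 → ∀ x ∈ Ω j, IsSelfAdjoint (φ x) := fun _ _ x _ => hφsa x
  -- `2α₁ ≤ c⋆₈` from `2 ≤ 5dLB₈`
  have ha2 : 2 * α₁ ≤ 5 * (d : ℝ) * L * B₈ * (α₀ + α₁) := by nlinarith only [hB8two, hα₀, hα₁]
  -- THE SOURCED BASE BODY at `B₀ := B₈`, for every exponent `A` of the datum, then the base adapter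
  refine hP5base_of_HFP_src hd2 hη L k hU₀ hU' hs84 hcs12 hα₁4 ha2 Ω Λs φ hInR h66 fun A hdat => ?_
  exact sockHFP₀_body_of_join_RD_src hd2 hL hη hk hΩ (htw 1 hk) hα₀ hα₁ hB₈ hB₀' rfl rfl hU₀ h33 h34 hAx hdat g Δ q qs Aw c g_rightΩ c_range hΔ
    hqs hq H' hB₀'H hB₂' hBG hBR hH0 hH1 hH2 hHsupp hHequiv hQH hG hGsupp hGreal hRbd hRreal le_rfl le_rfl le_rfl hα3 hα4 hsmall hc₃ hsc hα₃' hs₁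
    hs₂ hs₃ hs₄ hs₅ hs₆ hs₇ hsm hprod8 rfl rfl rfl rfl hcA' ha₁' hb₁' hθ hmf hf hfsa h103 h106

#print axioms sp5base_of_sockLettersRD_src_γ

end Literature.MathematicalPhysics.QuantumFieldTheory.Balaban1983to89.B8SockSP5BaseSrcGamma

end
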